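import Summits.QuantumFields.YangMills.Theorems.BalabanUVNodesC44IterMhDressing
import Literature.MathematicalPhysics.QuantumFieldTheory.Balaban1983to89.LatticeWordStokes
import HarnessLib

/-!
# (ℓa-C) ROAD B, FILE F4′-2c — THE (0.4) LOOP `Γ·[x,x′]·Γ′⁻¹·c⁻¹` IN THE INTERACTION PICTURE: the dressing factor of a loop is a product of FOUR unitarily rotated segment
# factors `D(Γ) · Ad_{W(Γ)}D([x,x′]) · Ad_{ωW(c)}D(Γ′)⁻¹ · Ad_{ω}D(c)⁻¹`

Cell `pub-ymgap` ∕ `ym-nodeO-ideate`, porter lineage `ymgap-nodeO-port-PTB-1` (gen 7), hand «(44) for `iterMh`» (director-ym g22 №569/№571; PORT-PLAN-v5 dc7ff9950b0ac185,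
§ F4′-2).  `--kind proof --supports stmt-QuantumFields-27238 --as helper`; count-neutral.  [B7] = [Balaban1985Averaging]; [B11] = [Balaban1985Variational]; [I] = [Balaban1987RG1].

WHY.  [I] (0.4) averages `(1/i)·log` of the loop variables `U(Γ ∪ [x,x′] ∪ (−Γ′) ∪ (−c))`; in the interaction picture of F4′-2b (`Ṽ(Γ) = D(Γ)W(Γ)`) the loop variable of the
perturbed complex field is `D(loop)·ω` with `ω` the background loop, and `D(loop)` splits along the four segments by the concatenation ∕ reversal rules — each segment factor
rotated by the background transport up to its starting point ([B7] (58)–(60) «rotated by `R(V₀(Γ_{y,b₋}))`»).  The transport in front of the reversed `Γ′` is `W(Γ)W([x,x′])W(Γ′)⋆ =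
ω·W(c)` (the background loop closes through the straight segment `c`), which is how the block-`y′` path family enters bond `c`'s average «through the next block centre» — the
origin of the COARSE-SITE DRIFT that F4′-3 re-gauges away.

WHAT IS PROVED (0 def, 0 sorry, axioms standard; ns `Summit.QuantumFields.YangMills.Theorems.C44IterMh`).
* §1 word lengths: `natAbs_off_le_L` (`|n_ν| ≤ L`; then `|Γ| ≤ d·L` is lit ✓`LatticeWordStokes.length_stairWord_le`, = ✓`Spine.NE7.length_stairWord_le`).
* §2 the four segments as walks: `walkEnd_stair_line_eq` (`y + n + Le_μ = y′ + n`), `walk_line_back_eq` (the segment `−c` is the reversed straight walk), ★ `walk_loopWord_eq_segments`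
  (the loop walk = `Γ` ++ `[x,x′]` ++ reversed `Γ′` (from `y′ = emb c₊`) ++ reversed `c`), ★ `loopM_coeField_eq` (`ω = W(Γ)·W([x,x′])·W(Γ′)⋆·W(c)⋆`).
* §3 ★★★ `dress_loop_eq` — `D(loop) = D(Γ) · (W(Γ)D([x,x′])W(Γ)⋆) · ((ωW(c))·D(Γ′)⁻¹·(ωW(c))⋆) · (ω·D(c)⁻¹·ω⋆)` for `SL(N,ℂ)`-valued `Ṽ` over the `SU(N)` background;
  `norm_dress_stair_sub_one_le` (`‖D(Γ) − 1‖ ≤ (1+2s)^{dL} − 1`), `norm_dress_line_sub_one_le` (`≤ (1+2s)^L − 1`), and the SHARP all-forward form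
  ★ `norm_dress_replicate_sub_one_le` ∕ `norm_dress_line_sub_one_le'` (`‖D([x,x′]) − 1‖, ‖D(c) − 1‖ ≤ (1+s)^L − 1` — coefficient exactly `L` at first order).

HONEST FRAMING.  Word ∕ walk bookkeeping and one algebraic identity over DEFINED objects; nothing of [B7] Props 1–3∕7 or [B11] (44) is proved here.  (ℓa-C)(ℓa-H)(ℓd) DISPLAYED;
(R1)∕(R2) OPEN; K0ᴬ ⟨stmt-QuantumFields-27238⟩ NOT closed; K0ᴬ∕K1ᴬ∕K3ᴬ 0∕3; NODE O 0∕1; COUNT 8∕28 · K 1∕4 UNMOVED; finite `𝕋⁴_{L^K}` at fixed ε — NOT continuum ∕ ℝ⁴ ∕ OS;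
**the Yang–Mills mass gap (Clay) is NOT proved by any of this.**  No `sorry`, `instance`, `notation`, `set_option`; standard axioms.
-/

noncomputable section

open scoped Matrix Matrix.Norms.L2Operator

namespace Summit.QuantumFields.YangMills.Theorems.C44IterMh

open Literature.MathematicalPhysics.QuantumFieldTheory.Balaban1983to89
open Literature.MathematicalPhysics.QuantumFieldTheory.Balaban1983to89.Node00
open T4Continuum BlockAveraging
open B15AveragingHolomorphic (stepMh holMh holMh_nil holMh_cons loopMh)

/-! ## §1  Word lengths: `|Γ^σ_{y,x}| = Σ_μ |n_μ| ≤ d·L` (lit ✓`LatticeWordStokes.length_stairWord_le`) -/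

section Loop

variable {P : Params} {j : ℕ} {N : ℕ}

/-- The centred offsets satisfy `|n_ν| ≤ (L−1)∕2 ≤ L`. [cite: Balaban1987RG1, (0.3) p.252] -/
theorem natAbs_off_le_L (r : Fin P.d → Fin P.L) (ν : Fin P.d) : (off r ν).natAbs ≤ P.L := by
  have h := off_bounds r ν
  have hL : (P.L - 1) / 2 ≤ P.L := (Nat.div_le_self _ _).trans (Nat.sub_le _ _)
  omega

/-! ## §2  The four segments of the (0.4) loop as walks -/

/-- `x′ = x + L e_μ = y′ + n`: the end of `Γ·[x,x′]` from `y = emb c₋` is the end of `Γ′` from `y′ = emb c₊`. [cite: Balaban1987RG1, (0.4) p.253 (bookkeeping)] -/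
theorem walkEnd_stair_line_eq (c : PBond P (j + 1)) (n : Fin P.d → ℤ) (σ σ' : Equiv.Perm (Fin P.d)) :
    walkEnd (walkEnd (emb c.src) (stairWord σ n)) (List.replicate P.L (c.dir, true)) = walkEnd (emb c.tgt) (stairWord σ' n) := by
  funext ν
  simp only [walkEnd_apply, netDisp_stairWord, T4ReflectionCone.netDisp_replicate, PBond.tgt, emb_shift_apply]
  by_cases h : c.dir = ν
  · subst h
    simp only [↓reduceIte, mul_one, Int.cast_natCast]
    ring
  · rw [if_neg h, if_neg (Ne.symm h), mul_zero, Int.cast_zero, add_zero, add_zero]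

/-- The segment `(−c)` is the REVERSED straight walk of `L` steps from `emb c₋` (read from its end `emb c₊`). [cite: Balaban1987RG1, (0.4) p.253 (bookkeeping)] -/
theorem walk_line_back_eq (c : PBond P (j + 1)) :
    walk (emb c.tgt) (List.replicate P.L (c.dir, false)) =
      walk (walkEnd (emb c.src) (List.replicate P.L (c.dir, true))) (wordRev (List.replicate P.L (c.dir, true))) := by
  rw [walkEnd_replicate_L, wordRev_replicate]
  rfl

/-- ★ **THE LOOP WALK IS THE CONCATENATION OF ITS FOUR SEGMENTS**: `Γ` from `y`, `[x,x′]` from `x`, `Γ′` reversed (from its end, a walk based at `y′ = emb c₊`), `c` reversed.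
[cite: Balaban1987RG1, (0.4) p.253] -/
theorem walk_loopWord_eq_segments (c : PBond P (j + 1)) (i : Idx P) :
    walk (emb c.src) (loopWord P.L c.dir (off i.1) i.2.1 i.2.2) =
      walk (emb c.src) (stairWord i.2.1 (off i.1)) ++
        (walk (walkEnd (emb c.src) (stairWord i.2.1 (off i.1))) (List.replicate P.L (c.dir, true)) ++
          (walk (walkEnd (emb c.tgt) (stairWord i.2.2 (off i.1))) (wordRev (stairWord i.2.2 (off i.1))) ++
            walk (emb c.tgt) (List.replicate P.L (c.dir, false)))) := by
  rw [loopWord, walk_append, walk_append, walk_append, walkEnd_stair_line_eq c (off i.1) i.2.1 i.2.2, walkEnd_walkEnd_wordRev]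

variable [NeZero N]

/-- ★ **THE BACKGROUND LOOP THROUGH ITS SEGMENTS**: `ω = W(Γ)·W([x,x′])·W(Γ′)⋆·W(c)⋆`. [cite: Balaban1987RG1, (0.4) p.253; Balaban1985Averaging, (9) p.19] -/
theorem loopM_coeField_eq (W : GaugeField P j (SU N)) (c : PBond P (j + 1)) (i : Idx P) :
    loopM (coeField W) c i =
      holM (coeField W) (walk (emb c.src) (stairWord i.2.1 (off i.1))) *
        holM (coeField W) (walk (walkEnd (emb c.src) (stairWord i.2.1 (off i.1))) (List.replicate P.L (c.dir, true))) *
          star (holM (coeField W) (walk (emb c.tgt) (stairWord i.2.2 (off i.1)))) *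
            star (holM (coeField W) (walk (emb c.src) (List.replicate P.L (c.dir, true)))) := by
  unfold loopM
  rw [walk_loopWord_eq_segments, holM_append', holM_append', holM_append', holM_coeField_walk_wordRev, walk_line_back_eq, holM_coeField_walk_wordRev]
  simp only [mul_assoc]

/-! ## §3  The dressing factor of the loop -/

/-- ★★★ **THE DRESSING FACTOR OF THE (0.4) LOOP IS A PRODUCT OF FOUR ROTATED SEGMENT FACTORS**:
`D(loop) = D(Γ) · (W(Γ)·D([x,x′])·W(Γ)⋆) · ((ωW(c))·D(Γ′)⁻¹·(ωW(c))⋆) · (ω·D(c)⁻¹·ω⋆)`, `ω` the background loop, `D(Γ′)`, `D(c)` the factors of `Γ′` from `y′` and of the straight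
segment from `y` — [B7] (58)–(60) along the four pieces of [I]'s loop, complex edition (inverses for the reversed pieces: `SL(N,ℂ)`-valued `Ṽ`).
[cite: Balaban1987RG1, (0.4) p.253; Balaban1985Averaging, (58) p.27, (60) p.28] -/
theorem dress_loop_eq (W : GaugeField P j (SU N)) {V : PBond P j → Matrix (Fin N) (Fin N) ℂ} (hdet : ∀ b, (V b).det = 1) (c : PBond P (j + 1)) (i : Idx P) :
    holMh V (walk (emb c.src) (loopWord P.L c.dir (off i.1) i.2.1 i.2.2)) * star (loopM (coeField W) c i) =
      (holMh V (walk (emb c.src) (stairWord i.2.1 (off i.1))) * star (holM (coeField W) (walk (emb c.src) (stairWord i.2.1 (off i.1))))) *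
      (holM (coeField W) (walk (emb c.src) (stairWord i.2.1 (off i.1))) *
        (holMh V (walk (walkEnd (emb c.src) (stairWord i.2.1 (off i.1))) (List.replicate P.L (c.dir, true))) *
          star (holM (coeField W) (walk (walkEnd (emb c.src) (stairWord i.2.1 (off i.1))) (List.replicate P.L (c.dir, true))))) *
        star (holM (coeField W) (walk (emb c.src) (stairWord i.2.1 (off i.1))))) *
      (loopM (coeField W) c i * holM (coeField W) (walk (emb c.src) (List.replicate P.L (c.dir, true))) *
        (holMh V (walk (emb c.tgt) (stairWord i.2.2 (off i.1))) * star (holM (coeField W) (walk (emb c.tgt) (stairWord i.2.2 (off i.1)))))⁻¹ *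
        star (loopM (coeField W) c i * holM (coeField W) (walk (emb c.src) (List.replicate P.L (c.dir, true))))) *
      (loopM (coeField W) c i *
        (holMh V (walk (emb c.src) (List.replicate P.L (c.dir, true))) * star (holM (coeField W) (walk (emb c.src) (List.replicate P.L (c.dir, true)))))⁻¹ *
        star (loopM (coeField W) c i)) := by
  have hω := loopM_coeField_eq W c i
  conv_lhs => rw [show loopM (coeField W) c i = holM (coeField W) (walk (emb c.src) (loopWord P.L c.dir (off i.1) i.2.1 i.2.2)) from rfl]
  rw [walk_loopWord_eq_segments, dress_append, dress_append, dress_append, dress_walk_wordRev W hdet (emb c.tgt) (stairWord i.2.2 (off i.1)), walk_line_back_eq,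
    dress_walk_wordRev W hdet (emb c.src) (List.replicate P.L (c.dir, true)), holM_coeField_walk_wordRev, hω]
  simp only [mul_assoc, star_mul, star_star, star_holM_mul_holM_mul, holM_mul_star_holM_mul, star_holM_mul_holM, mul_one]

/-- `‖D(Γ) − 1‖ ≤ (1+2s)^{dL} − 1` for every staircase contour of a block. [cite: Balaban1985Averaging, (47) p.25; Balaban1987RG1, (0.3) p.252] -/
theorem norm_dress_stair_sub_one_le (W : GaugeField P j (SU N)) {V : PBond P j → Matrix (Fin N) (Fin N) ℂ} (hdet : ∀ b, (V b).det = 1) {s : ℝ}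
    (hs : ∀ b, ‖V b * star (W b : Matrix (Fin N) (Fin N) ℂ) - 1‖ ≤ s) (hs2 : s ≤ 1 / 2) (z : Site P j) (σ : Equiv.Perm (Fin P.d)) (r : Fin P.d → Fin P.L) :
    ‖holMh V (walk z (stairWord σ (off r))) * star (holM (coeField W) (walk z (stairWord σ (off r)))) - 1‖ ≤ (1 + 2 * s) ^ (P.d * P.L) - 1 := by
  have hs0 : 0 ≤ s := (norm_nonneg _).trans (hs ⟨z, σ 0⟩)
  refine (norm_dress_walk_sub_one_le W hdet hs hs2 z _).trans ?_
  have h1 : (1 : ℝ) ≤ 1 + 2 * s := by linarith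
  linarith [pow_le_pow_right₀ h1 (LatticeWordStokes.length_stairWord_le σ (off r) P.L (natAbs_off_le_L r))]

/-- `‖D([x,x′]) − 1‖, ‖D(c) − 1‖ ≤ (1+2s)^L − 1` for the straight walks of `L` steps. [cite: Balaban1985Averaging, (47) p.25; Balaban1987RG1, (0.4) p.253] -/
theorem norm_dress_line_sub_one_le (W : GaugeField P j (SU N)) {V : PBond P j → Matrix (Fin N) (Fin N) ℂ} (hdet : ∀ b, (V b).det = 1) {s : ℝ}
    (hs : ∀ b, ‖V b * star (W b : Matrix (Fin N) (Fin N) ℂ) - 1‖ ≤ s) (hs2 : s ≤ 1 / 2) (z : Site P j) (μ : Fin P.d) :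
    ‖holMh V (walk z (List.replicate P.L (μ, true))) * star (holM (coeField W) (walk z (List.replicate P.L (μ, true)))) - 1‖ ≤ (1 + 2 * s) ^ P.L - 1 := by
  have h := norm_dress_walk_sub_one_le W hdet hs hs2 z (List.replicate P.L (μ, true))
  rwa [List.length_replicate] at h

/-- ★ **SHARP BOUND FOR THE STRAIGHT SEGMENT** (all steps forward, each factor within `s` of `1`): `‖D(walk z (+e_μ)^n) − 1‖ ≤ (1+s)^n − 1` — the main term `L·s` of the
one-step recursion comes with coefficient exactly `L` (print's `|Q₀A| ≤ |A|` after the `L^{-1}` normalisation, [B7] (125)–(126)). [cite: Balaban1985Averaging, (125)–(126) p.36] -/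
theorem norm_dress_replicate_sub_one_le (W : GaugeField P j (SU N)) {V : PBond P j → Matrix (Fin N) (Fin N) ℂ} {s : ℝ}
    (hs : ∀ b, ‖V b * star (W b : Matrix (Fin N) (Fin N) ℂ) - 1‖ ≤ s) (μ : Fin P.d) : ∀ (n : ℕ) (z : Site P j),
    ‖holMh V (walk z (List.replicate n (μ, true))) * star (holM (coeField W) (walk z (List.replicate n (μ, true)))) - 1‖ ≤ (1 + s) ^ n - 1
  | 0, z => by simp [walk, holMh_nil, holM_nil]
  | n + 1, z => by
    have ih := norm_dress_replicate_sub_one_le W hs μ n (walkEnd z [(μ, true)])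
    rw [List.replicate_succ, show (μ, true) :: List.replicate n (μ, true) = [(μ, true)] ++ List.replicate n (μ, true) from rfl, walk_append, dress_append]
    have h1 : ‖holMh V (walk z [(μ, true)]) * star (holM (coeField W) (walk z [(μ, true)])) - 1‖ ≤ s := by
      show ‖holMh V [⟨⟨z, μ⟩, true⟩] * star (holM (coeField W) [⟨⟨z, μ⟩, true⟩]) - 1‖ ≤ s
      rw [dress_single_true]
      exact hs _
    have h2 : ‖holM (coeField W) (walk z [(μ, true)]) *
        (holMh V (walk (walkEnd z [(μ, true)]) (List.replicate n (μ, true))) * star (holM (coeField W) (walk (walkEnd z [(μ, true)]) (List.replicate n (μ, true))))) *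
        star (holM (coeField W) (walk z [(μ, true)])) - 1‖ ≤ (1 + s) ^ n - 1 := by
      rw [norm_unitary_conj_sub_one_eq (holM_coeField_mem_unitaryGroup W _)]
      exact ih
    refine (norm_mul_sub_one_le_of_le₂ h1 h2).trans (le_of_eq ?_)
    rw [pow_succ]
    ring

/-- The straight segments `[x,x′]` and `c` of (0.4) have `L` forward steps: `‖D − 1‖ ≤ (1+s)^L − 1`. [cite: Balaban1987RG1, (0.4) p.253; Balaban1985Averaging, (125) p.36] -/
theorem norm_dress_line_sub_one_le' (W : GaugeField P j (SU N)) {V : PBond P j → Matrix (Fin N) (Fin N) ℂ} {s : ℝ}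
    (hs : ∀ b, ‖V b * star (W b : Matrix (Fin N) (Fin N) ℂ) - 1‖ ≤ s) (z : Site P j) (μ : Fin P.d) :
    ‖holMh V (walk z (List.replicate P.L (μ, true))) * star (holM (coeField W) (walk z (List.replicate P.L (μ, true)))) - 1‖ ≤ (1 + s) ^ P.L - 1 :=
  norm_dress_replicate_sub_one_le W hs μ P.L z

end Loop

end Summit.QuantumFields.YangMills.Theorems.C44IterMh

end
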